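import Summits.KontsevichZagierPeriods.KontsevichZagierPeriods.Theorems.LinRedNormalFormArrangementNormalFormStubRebaseSimpleZeroNestedTools

/-!
# Stub `stub_rebaseSimpleZeroMany`, part `rebaseSimpleZeroMany_common` (crux `ArrangementNormalForm`,
line `janus-bands`) — brick `ChainTools`

Dictionary for the dissection of a CLEAN CHAIN `A(y) < t₀ < t₁ < ⋯ < tₙ < B(y)` of `n + 1`
fibres over a one-dimensional base `y` (literal class `GS 0 (n + 1)`, simple base pole) whose
letters are constants — the `K`-fibre analogue of `RebaseNest.IsNest` (worker W3, pairs):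
* `RebaseChain.clo/chi` — the bound data of the clean chain in index order, `RebaseChain.mem_chain`
  (membership: `y ∈ cell M`, `A(y) < t₀`, `t` strictly increasing, `tₙ < B(y)`);
* `RebaseChain.IsChain s M A B T p a` — `s` is the clean chain over the base cell `cell M` with
  base-factor data `T` (`n₁ = 0`, `n₂ = 1`), numerator `p`, constant letters `a`, bounded domain;
* the elementary moves: `IsChain.good_empty/good_cell_empty`, `IsChain.rowSplit` (cut the base
  at a rational point, rule 1a), `IsChain.cell_bound`, `RebaseChain.isBounded_chainDom`,
  `RebaseChain.shear` (joint shear of all fibres along the common letter slope `λ`, rule 2: the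
  letters become constants, the chain stays a chain).
Registered: `rebaseSimpleZeroMany_chainShear`.

References: M. Kontsevich, D. Zagier, *Periods* (2001), §1.2, rules (1a), (2).
-/

noncomputable section

open Set MeasureTheory MvPolynomial
open Literature.NumberTheory.Transcendental Literature.ModelTheory.ExponentialFields

namespace Summit.KontsevichZagierPeriods.ArrangementNormalForm.JanusBands

namespace RebaseChain

open SeparatePos RebasePos RebaseZero

variable {n k m' : ℕ}

/-! ### Rows and links -/

/-- The rows of the literal text cut out the base cell (any number of fibres). [folklore] -/
theorem rows_iffK (M : Fin m' → Cf) (z : Fin (0 + 1 + k) → ℝ) :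
    (∀ r, 0 < affF 0 k (M r) z) ↔ yv z ∈ cell M := by
  simp only [affF_eq, cell, mem_setOf_eq]

/-- **Monotonicity along links.** If `f (castSucc j) < f (succ j)` for all links `j` between `u`
and `v`, then `f` is strictly increasing on `[u, v]`. [folklore] -/
theorem lt_of_links {α : Type*} [Preorder α] (f : Fin (n + 1) → α) {u v : Fin (n + 1)}
    (h : ∀ j : Fin n, u ≤ j.castSucc → j.succ ≤ v → f j.castSucc < f j.succ) {i i' : Fin (n + 1)}
    (hu : u ≤ i) (hii' : i < i') (hv : i' ≤ v) : f i < f i' := by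
  have key : ∀ (d : ℕ) (i' : Fin (n + 1)), i'.val = i.val + d + 1 → i' ≤ v → f i < f i' := by
    intro d
    induction d with
    | zero =>
      intro i' hd hv
      have hi : i.val < n := by have := i'.isLt; omega
      set j : Fin n := ⟨i.val, hi⟩ with hj
      have hc : j.castSucc = i := Fin.ext rfl
      have hs : j.succ = i' := Fin.ext (by rw [Fin.val_succ, hd])
      have := h j (by rw [hc]; exact hu) (by rw [hs]; exact hv)
      rwa [hc, hs] at this
    | succ d ih =>
      intro i' hd hv
      have hi'' : i.val + d + 1 < n + 1 := by have := i'.isLt; omega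
      set i'' : Fin (n + 1) := ⟨i.val + d + 1, hi''⟩ with hi''def
      have hle : i'' ≤ i' := Fin.le_def.2 (by rw [hd]; simp [hi''def])
      have h1 := ih i'' rfl (hle.trans hv)
      have hj : i.val + d + 1 < n := by have := i'.isLt; omega
      set j : Fin n := ⟨i.val + d + 1, hj⟩ with hjdef
      have hc : j.castSucc = i'' := Fin.ext rfl
      have hs : j.succ = i' := Fin.ext (by rw [Fin.val_succ, hd]; simp [hjdef]; omega)
      have hui'' : u ≤ i'' := hu.trans (Fin.le_def.2 (by simp [hi''def]; omega))
      have h2 := h j (by rw [hc]; exact hui'') (by rw [hs]; exact hv)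
      rw [hc, hs] at h2
      exact lt_trans h1 h2
  exact key (i'.val - i.val - 1) i' (by have := Fin.lt_def.1 hii'; omega) hv

/-! ### The clean chain -/

/-- Lower bounds of the clean chain `A < t₀ < t₁ < ⋯`: the form `A` under `t₀`, the fibre `tⱼ`
under `tⱼ₊₁`. -/
def clo (A : Cf) : Fin (n + 1) → Fin (n + 1) ⊕ Cf :=
  Fin.cases (Sum.inr A) fun j => Sum.inl j.castSucc

/-- Upper bounds of the clean chain `⋯ < tₙ₋₁ < tₙ < B`: the form `B` over `tₙ`, the fibre `tⱼ₊₁`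
over `tⱼ`. -/
def chi (Bd : Cf) : Fin (n + 1) → Fin (n + 1) ⊕ Cf := fun i =>
  Fin.lastCases (Sum.inr Bd) (fun j => Sum.inl j.succ) i

/-- The lower bound of the first fibre. -/
@[simp] theorem clo_zero (A : Cf) : clo (n := n) A 0 = Sum.inr A := rfl

/-- The lower bound of a later fibre is the previous fibre. -/
@[simp] theorem clo_succ (A : Cf) (j : Fin n) : clo A j.succ = Sum.inl j.castSucc := rfl

/-- The upper bound of the last fibre. -/
@[simp] theorem chi_last (Bd : Cf) : chi (n := n) Bd (Fin.last n) = Sum.inr Bd := Fin.lastCases_last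

/-- The upper bound of an earlier fibre is the next fibre. -/
@[simp] theorem chi_castSucc (Bd : Cf) (j : Fin n) : chi Bd j.castSucc = Sum.inl j.succ :=
  Fin.lastCases_castSucc j

/-- An affine lower bound of the clean chain is `A`. -/
theorem clo_eq_inr {A c : Cf} {i : Fin (n + 1)} (h : clo A i = Sum.inr c) : c = A := by
  induction i using Fin.cases with
  | zero => rw [clo_zero] at h; cases h; rfl
  | succ j => rw [clo_succ] at h; cases h

/-- An affine upper bound of the clean chain is `B`. -/
theorem chi_eq_inr {Bd c : Cf} {i : Fin (n + 1)} (h : chi Bd i = Sum.inr c) : c = Bd := by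
  induction i using Fin.lastCases with
  | last => rw [chi_last] at h; cases h; rfl
  | cast j => rw [chi_castSucc] at h; cases h

/-- Membership in the literal domain, read through the players. [folklore] -/
theorem mem_gDom_iff (M : Fin m' → Cf) (lo hi : Fin k → Fin k ⊕ Cf) (z : Fin (0 + 1 + k) → ℝ) :
    z ∈ gDom 0 k m' M lo hi ↔ yv z ∈ cell M ∧ ∀ i, pv (lo i) z < tv z i ∧ tv z i < pv (hi i) z := by
  rw [← rows_iffK M z]
  rfl

/-- **Membership in the clean chain**: `y ∈ cell M`, `A(y) < t₀`, `t` strictly increasing,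
`tₙ < B(y)`. -/
theorem mem_chain (M : Fin m' → Cf) (A Bd : Cf) (z : Fin (0 + 1 + (n + 1)) → ℝ) :
    z ∈ gDom 0 (n + 1) m' M (clo A) (chi Bd) ↔
      yv z ∈ cell M ∧ ev A (yv z) < tv z 0 ∧ StrictMono (tv z) ∧ tv z (Fin.last n) < ev Bd (yv z) := by
  rw [mem_gDom_iff, Fin.strictMono_iff_lt_succ, forall_and, Fin.forall_fin_succ, Fin.forall_fin_succ']
  simp only [clo_zero, clo_succ, chi_last, chi_castSucc, RebaseZero.pv_inr, RebaseZero.pv_inl]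
  constructor
  · rintro ⟨hy, ⟨h0, hl⟩, -, hn⟩
    exact ⟨hy, h0, hl, hn⟩
  · rintro ⟨hy, h0, hl, hn⟩
    exact ⟨hy, ⟨h0, hl⟩, hl, hn⟩

/-- `s` is the CLEAN CHAIN `A < t₀ < ⋯ < tₙ < B` over the base cell `cell M`, with base-factor
data `T` (simple base pole: `n₁ = 0`, `n₂ = 1`), numerator `p` and CONSTANT letters `a`, on a
bounded domain. [folklore] -/
structure IsChain (s : KZ.IntegralRep (0 + 1 + (n + 1))) {m' : ℕ} (M : Fin m' → Cf) (A Bd : Cf)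
    (T : BData) (p : MvPolynomial (Fin 0) ℚ) (a : Fin (n + 1) → Option Cf) : Prop where
  /-- the domain is the clean chain -/
  dom : s.domain = gDom 0 (n + 1) m' M (clo A) (chi Bd)
  /-- the integrand is the literal one -/
  int : EqOn s.integrand (glitB T p a) s.domain
  /-- no numerator power of the base -/
  n1 : T.n₁ = 0
  /-- simple base pole -/
  n2 : T.n₂ = 1
  /-- constant letters -/
  a0 : ∀ l c, a l = some c → c.1 (Fin.last 0) = 0
  /-- bounded domain -/
  bdd : Bornology.IsBounded s.domain

variable {s : KZ.IntegralRep (0 + 1 + (n + 1))} {M : Fin m' → Cf} {A Bd : Cf} {T : BData}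
  {p : MvPolynomial (Fin 0) ℚ} {a : Fin (n + 1) → Option Cf}

/-- Membership in the domain of a clean chain. -/
theorem IsChain.mem (h : IsChain s M A Bd T p a) (z : Fin (0 + 1 + (n + 1)) → ℝ) : z ∈ s.domain ↔
    yv z ∈ cell M ∧ ev A (yv z) < tv z 0 ∧ StrictMono (tv z) ∧ tv z (Fin.last n) < ev Bd (yv z) := by
  rw [h.dom, mem_chain]

/-! ### Elementary goodness -/

/-- **Empty fibres**: if `B ≤ A` on the base cell, the clean chain is good (empty domain). -/
theorem IsChain.good_empty (h : IsChain s M A Bd T p a) (he : ∀ y ∈ cell M, ev Bd y ≤ ev A y) :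
    Good (n + 1) (KZ.of s) :=
  RebaseNest.good_of_dom_empty s fun z hz => by
    obtain ⟨hy, h1, h2, h3⟩ := (h.mem z).1 hz
    have h4 : tv z 0 ≤ tv z (Fin.last n) := h2.monotone (Fin.zero_le _)
    linarith [he _ hy]

/-- **Empty base cell**: a clean chain over an empty base cell is good. -/
theorem IsChain.good_cell_empty (h : IsChain s M A Bd T p a) (he : ∀ y, y ∉ cell M) :
    Good (n + 1) (KZ.of s) :=
  RebaseNest.good_of_dom_empty s fun z hz => he _ ((h.mem z).1 hz).1

/-! ### Cutting the base -/

/-- **Cutting the base cell at a rational point** (rule 1a, `RebasePos.cutBase`): if both pieces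
(extra row `±q`) are good, so is the clean chain. -/
theorem IsChain.rowSplit (h : IsChain s M A Bd T p a) (q : Cf) (hq : q ≠ 0)
    (h₁ : ∀ s₁ : KZ.IntegralRep (0 + 1 + (n + 1)),
      IsChain s₁ (Fin.snoc M q : Fin (m' + 1) → Cf) A Bd T p a → Good (n + 1) (KZ.of s₁))
    (h₂ : ∀ s₂ : KZ.IntegralRep (0 + 1 + (n + 1)),
      IsChain s₂ (Fin.snoc M (-q) : Fin (m' + 1) → Cf) A Bd T p a → Good (n + 1) (KZ.of s₂)) :
    Good (n + 1) (KZ.of s) := by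
  obtain ⟨s₁, s₂, hm₁, hm₂, hi₁, hi₂, hd₁, hd₂, hrel⟩ := cutBase s M (clo A) (chi Bd) h.dom q hq
  have hs₁ : s₁.domain ⊆ s.domain := fun z hz => ((hm₁ z).1 hz).1
  have hs₂ : s₂.domain ⊆ s.domain := fun z hz => ((hm₂ z).1 hz).1
  refine good_of_rel3 hrel (h₁ s₁ ⟨hd₁, fun z hz => ?_, h.n1, h.n2, h.a0, h.bdd.subset hs₁⟩)
    (h₂ s₂ ⟨hd₂, fun z hz => ?_, h.n1, h.n2, h.a0, h.bdd.subset hs₂⟩)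
  · rw [hi₁]; exact h.int (hs₁ hz)
  · rw [hi₂]; exact h.int (hs₂ hz)

/-! ### Boundedness -/

/-- The equally spaced points of `(u, v)`: `u + (v − u)(i + 1)/(n + 2)`. [folklore] -/
theorem strictMono_grid {u v : ℝ} (huv : u < v) :
    StrictMono fun i : Fin (n + 1) => u + (v - u) * ((i : ℝ) + 1) / ((n : ℝ) + 2) := by
  intro i i' hii'
  have hlt : (i : ℝ) < i' := by exact_mod_cast Fin.lt_def.1 hii'
  have hpos : (0 : ℝ) < (n : ℝ) + 2 := by positivity
  have h1 : (v - u) * ((i : ℝ) + 1) < (v - u) * ((i' : ℝ) + 1) := by nlinarith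
  have := div_lt_div_of_pos_right h1 hpos
  linarith

/-- The base cell of a clean chain with NON-EMPTY fibres is bounded (it is the projection of the
domain: lift `y` to the point with equally spaced fibres in `(A, B)`). -/
theorem IsChain.cell_bound (h : IsChain s M A Bd T p a) (hAB : ∀ y ∈ cell M, ev A y < ev Bd y) :
    ∃ R : ℝ, ∀ y ∈ cell M, |y| ≤ R := by
  obtain ⟨R, hR⟩ := h.bdd.exists_norm_le
  refine ⟨R, fun y hy => ?_⟩
  have hlt := hAB y hy
  set g : Fin (n + 1) → ℝ := fun i => ev A y + (ev Bd y - ev A y) * ((i : ℝ) + 1) / ((n : ℝ) + 2)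
    with hgdef
  set z : Fin (0 + 1 + (n + 1)) → ℝ := Fin.append (fun _ : Fin (0 + 1) => y) g with hzdef
  have hyv : yv z = y := by
    simp only [yv, yIdx, hzdef, Fin.append_left]
  have htv : ∀ i, tv z i = g i := fun i => by
    simp only [tv, tIdx, hzdef, Fin.append_right]
  have hpos : (0 : ℝ) < (n : ℝ) + 2 := by positivity
  have hz : z ∈ s.domain := by
    rw [h.mem, hyv, show tv z = g from funext htv]
    refine ⟨hy, ?_, strictMono_grid hlt, ?_⟩
    · simp only [hgdef, Fin.val_zero, Nat.cast_zero, zero_add, mul_one]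
      have : 0 < (ev Bd y - ev A y) / ((n : ℝ) + 2) := div_pos (sub_pos.2 hlt) hpos
      linarith
    · simp only [hgdef, Fin.val_last]
      have h1 : (ev Bd y - ev A y) * ((n : ℝ) + 1) / ((n : ℝ) + 2) < ev Bd y - ev A y := by
        rw [div_lt_iff₀ hpos]; nlinarith
      linarith
  have h1 := norm_le_pi_norm z (yIdx (n + 1))
  rw [Real.norm_eq_abs, show z (yIdx (n + 1)) = y from hyv] at h1
  exact h1.trans (hR _ hz)

/-- A clean chain over a bounded base cell has a bounded domain. [folklore] -/
theorem isBounded_chainDom (M : Fin m' → Cf) {R : ℝ} (hR : ∀ y ∈ cell M, |y| ≤ R) (A Bd : Cf) :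
    Bornology.IsBounded (gDom 0 (n + 1) m' M (clo A) (chi Bd)) := by
  set C : ℝ := (|(A.1 (Fin.last 0) : ℝ)| + |(Bd.1 (Fin.last 0) : ℝ)|) * R + (|(A.2 : ℝ)| + |(Bd.2 : ℝ)|)
    with hC
  refine IntegrateOutLow.isBounded_of_forall_abs_le (R + C) fun z hz l => ?_
  obtain ⟨hy, h1, h2, h3⟩ := (mem_chain M A Bd z).1 hz
  have hyR := hR _ hy
  have hR0 : 0 ≤ R := (abs_nonneg _).trans hyR
  have hA := abs_ev_le_of A hyR
  have hB := abs_ev_le_of Bd hyR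
  have hC0 : 0 ≤ C := by positivity
  have ht : ∀ t : ℝ, ev A (yv z) < t → t < ev Bd (yv z) → |t| ≤ R + C := fun t ht1 ht2 => by
    rw [abs_le] at hA hB ⊢
    constructor <;> nlinarith [abs_nonneg ((A.1 (Fin.last 0) : ℝ)), abs_nonneg ((Bd.1 (Fin.last 0) : ℝ)),
      abs_nonneg (A.2 : ℝ), abs_nonneg (Bd.2 : ℝ)]
  rcases idx_cases l with rfl | ⟨l, rfl⟩
  · exact hyR.trans (le_add_of_nonneg_right hC0)
  · have hlo : ev A (yv z) < tv z l := h1.trans_le (h2.monotone (Fin.zero_le l))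
    have hhi : tv z l < ev Bd (yv z) := (h2.monotone (Fin.le_last l)).trans_lt h3
    exact ht (tv z l) hlo hhi

/-! ### Joint pull-backs of all fibres -/

/-- Constant pull-back data are linked-compatible (any number of fibres). -/
theorem hlink_constK (μ₀ α₀ : ℚ) (lo hi : Fin k → Fin k ⊕ Cf) : ∀ l l' : Fin k,
    (lo l = Sum.inl l' ∨ hi l = Sum.inl l') → (fun _ : Fin k => μ₀) l = (fun _ : Fin k => μ₀) l' ∧
      (fun _ : Fin k => α₀) l = (fun _ : Fin k => α₀) l' ∧
      (fun _ : Fin k => (0 : (Fin 0 → ℚ) × ℚ)) l = (fun _ : Fin k => (0 : (Fin 0 → ℚ) × ℚ)) l' :=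
  fun _ _ _ => ⟨rfl, rfl, rfl⟩

/-- The sheared lower bounds of a clean chain. -/
theorem pullLo_shear (lam : ℚ) (A Bd : Cf) :
    pullLo (fun _ : Fin (n + 1) => (1 : ℚ)) (fun _ => lam) (fun _ => 0) (clo A) (chi Bd) =
      clo (pullC 1 lam 0 A) := by
  funext l
  simp only [pullLo, zero_lt_one, if_true]
  induction l using Fin.cases with
  | zero => simp
  | succ j => simp

/-- The sheared upper bounds of a clean chain. -/
theorem pullHi_shear (lam : ℚ) (A Bd : Cf) :
    pullHi (fun _ : Fin (n + 1) => (1 : ℚ)) (fun _ => lam) (fun _ => 0) (clo A) (chi Bd) =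
      chi (pullC 1 lam 0 Bd) := by
  funext l
  simp only [pullHi, zero_lt_one, if_true]
  induction l using Fin.lastCases with
  | last => simp
  | cast j => simp

/-- **Joint shear along the common letter slope** (rule 2, `tₗ ↦ tₗ + λ y` on all fibres): a
clean chain with letters of common `y`-slope `λ` and a simple base pole becomes a clean chain
with CONSTANT letters (`RebaseChain.IsChain`). -/
theorem shear {m n₁ n₂ : ℕ} (s : KZ.IntegralRep (0 + 1 + (n + 1))) (M : Fin m' → Cf)
    (L : Fin m → (Fin 0 → ℚ) × ℚ) (e : Fin m → ℕ) (p : MvPolynomial (Fin 0) ℚ) (ℓ₁ ℓ₂ : (Fin 0 → ℚ) × ℚ)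
    (a : Fin (n + 1) → Option Cf) (A Bd : Cf) (h1 : n₁ = 0) (hn : n₂ = 1)
    (hbd : Bornology.IsBounded s.domain) (hdom : s.domain = gDom 0 (n + 1) m' M (clo A) (chi Bd))
    (hint : EqOn s.integrand (glit 0 (n + 1) p L e ℓ₁ ℓ₂ n₁ n₂ a) s.domain) (lam : ℚ)
    (ha : ∀ l c, a l = some c → c.1 (Fin.last 0) = lam) :
    ∃ s' : KZ.IntegralRep (0 + 1 + (n + 1)), IsChain s' M (pullC 1 lam 0 A) (pullC 1 lam 0 Bd)
      ⟨m, L, e, ℓ₁, ℓ₂, n₁, n₂⟩ (C (pullQ (fun _ : Fin (n + 1) => (1 : ℚ)) a) * p)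
      (pullA (fun _ : Fin (n + 1) => (1 : ℚ)) (fun _ => lam) (fun _ => 0) a) ∧
      KZ.of s - KZ.of s' ∈ KZ.relations := by
  obtain ⟨s', -, hbd', hdom', hint', hrel⟩ := pull (fun _ : Fin (n + 1) => (1 : ℚ)) (fun _ => lam)
    (fun _ => 0) s M L e p ℓ₁ ℓ₂ n₁ n₂ a (clo A) (chi Bd) hbd hdom hint (fun _ => one_ne_zero)
    (hlink_constK 1 lam _ _)
  refine ⟨s', ⟨?_, hint', h1, hn, fun l c hc => ?_, hbd'⟩, hrel⟩
  · rw [hdom', pullLo_shear, pullHi_shear]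
  · rcases h' : a l with _ | c₀
    · simp [pullA, h'] at hc
    · simp only [pullA, h', Option.map_some, Option.some.injEq] at hc
      rw [← hc, pullC_fst_last, ha l c₀ h', sub_self, zero_div]

end RebaseChain

/-- Registered support goal of this file (part of `rebaseSimpleZeroMany_common`): the joint shear
of a clean chain of `n + 1` fibres along the common letter slope (`RebaseChain.shear`). -/
theorem rebaseSimpleZeroMany_chainShear (n m m' n₁ n₂ : ℕ) (s : KZ.IntegralRep (0 + 1 + (n + 1))) (M : Fin m' → (Fin (0 + 1) → ℚ) × ℚ) (L : Fin m → (Fin 0 → ℚ) × ℚ) (e : Fin m → ℕ) (p : MvPolynomial (Fin 0) ℚ) (ℓ₁ ℓ₂ : (Fin 0 → ℚ) × ℚ) (a : Fin (n + 1) → Option ((Fin (0 + 1) → ℚ) × ℚ)) (A Bd : (Fin (0 + 1) → ℚ) × ℚ) (h1 : n₁ = 0) (hn : n₂ = 1) (hbd : Bornology.IsBounded s.domain) (hdom : s.domain = SeparatePos.gDom 0 (n + 1) m' M (RebaseChain.clo A) (RebaseChain.chi Bd)) (hint : EqOn s.integrand (RebasePos.glit 0 (n + 1) p L e ℓ₁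 ℓ₂ n₁ n₂ a) s.domain) (lam : ℚ) (ha : ∀ l c, a l = some c → c.1 (Fin.last 0) = lam) : ∃ s' : KZ.IntegralRep (0 + 1 + (n + 1)), RebaseChain.IsChain s' M (RebasePos.pullC 1 lam 0 A) (RebasePos.pullC 1 lam 0 Bd) ⟨m, L, e, ℓ₁, ℓ₂, n₁, n₂⟩ (MvPolynomial.C (RebasePos.pullQ (fun _ : Fin (n + 1) => (1 : ℚ)) a) * p) (RebasePos.pullA (fun _ : Fin (n + 1) => (1 : ℚ)) (fun _ => lam) (fun _ => 0) a) ∧ KZ.of s - KZ.of s' ∈ KZ.relations :=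
  RebaseChain.shear s M L e p ℓ₁ ℓ₂ a A Bd h1 hn hbd hdom hint lam ha

end Summit.KontsevichZagierPeriods.ArrangementNormalForm.JanusBands
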